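import Literature.NumberTheory.LFunctions.ZetaScrewLaplace
import Literature.NumberTheory.LFunctions.LandauOscillation
import Literature.NumberTheory.LFunctions.GeneralizedRH
import Literature.NumberTheory.LFunctions.ZetaScrewSeriesProofs
import Literature.NumberTheory.LFunctions.WeilZeroSum
import Mathlib.Analysis.SpecialFunctions.ImproperIntegrals
import Mathlib.Topology.MetricSpace.Thickening
import Mathlib.Analysis.Analytic.Order
import Mathlib.Analysis.Analytic.Uniqueness
import Mathlib.Analysis.Calculus.Deriv.Shift
import HarnessLib

/-!
# Suzuki's Theorem 1.7 — RH iff `Ψ ≥ 0`, and `Ψ > 0` off `0` under RH: proofs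

M. Suzuki, *Aspects of the screw function corresponding to the Riemann zeta-function*,
J. Lond. Math. Soc. (2) 108 (2023) 1448–1487 = arXiv:2206.03682 [Suzuki2023], Theorem 1.7:

> The RH is true if and only if `Ψ(t)` is pointwise non-negative, that is, `Ψ(t) ≥ 0` for every
> `t ∈ ℝ`. Further, if RH is true, `Ψ(t) > 0` when `t ≠ 0`.

Here `Ψ = zetaScrew` (`ZetaScrew.lean`, (1.1) of the paper). This sibling proofs file of
`ZetaScrew.lean` PROVES the named fact `Literature.NumberTheory.LFunctions.Suzuki2023_thm17`:
`Suzuki2023_thm17_holds`, following §7.2 of the paper. It uses the tree's proofs of Thm 1.1 (1)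
(`Suzuki2023_thm11_fourier_holds`, `ZetaScrewLaplace.lean`) and of Thm 1.1 (2)
(`Suzuki2023_thm11_series_of_fourier`, `ZetaScrewSeriesProofs.lean`).

## Part 1: `Ψ ≥ 0 ⇒ RH` (§7.2, "the well-known result for the Laplace transform for non-negative functions [Wi41]")

> "Conversely, suppose that `Ψ(t) ≥ 0` for `t > 0`. Because `ζ(s)` has no zeros in the half-line
> `[1/2, ∞)` …, the logarithmic derivative `(ξ'/ξ)(1/2 - iz)` has no poles in the half-line
> `i·[0, ∞)` of the imaginary axis. Then, by the integral formula (1.2) and the well-known result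
> for the Laplace transform for non-negative functions ([Wi41]), `(ξ'/ξ)(1/2 - iz)` has no poles
> in `ℂ₊`, which implies that the RH is true."

In the tree's language (namespace `ZetaScrewLandau`): put `g(x) = Ψ(log x)`, so that the Mellin
transform of the tree's Landau lemma is the Laplace transform of `Ψ`:
`Landau.mellinIoi g s = ∫_1^∞ Ψ(log x) x^{-(s+1)} dx = ∫_0^∞ Ψ(t) e^{-st} dt`
(`mellinIoi_zetaScrew_log`). By Thm 1.1 (1) (in the Laplace variable:
`ZetaScrewLaplace.integral_zetaScrew_mul_cexp`) this converges absolutely for `Re s > 1/2` and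
equals `R(s) = s^{-2} (ξ'/ξ)(1/2 + s)` there. `R` is holomorphic at every `s ≠ 0` with
`ξ(1/2 + s) ≠ 0`, in particular near every point of the real ray `(0, ∞)` (no real zeros of `ξ`:
`riemannXi_zero_prop`), hence on a thin open rectangle `W₀` around any compact real segment
`[ε/2, 3]` (`IsCompact.exists_thickening_subset_open`). If `Ψ ≥ 0`, Landau's lemma
(`Landau.integrableOn_of_differentiableOn_union_convex`, Montgomery–Vaughan Lemma 15.1) pushes the
abscissa of absolute convergence below any `ε > 0`, so `F = mellinIoi g` is holomorphic on
`Re s > ε` and, by the identity theorem, `F(s) s² ξ(1/2+s) = ξ'(1/2+s)` there. At a zero `w₀` of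
`ξ(1/2 + ·)` with `Re w₀ > 0` (take `ε = Re w₀ / 2`) this says `Z' = G·Z` near `w₀` with
`G = F s²` holomorphic and `Z = ξ(1/2 + ·)`, impossible for a zero of finite order
(`AnalyticAt.analyticOrderAt_deriv_add_one`: `ord Z' + 1 = ord Z`, while `ord (G Z) ≥ ord Z`),
and `Z ≢ 0`. Hence `ζ` has no zeros with `1/2 < Re s < 1` (`riemannXi_eq_zero_iff_holds`), which
is RH by the functional equation (`quasiRiemannHypothesis_one_half_iff_holds`):
`riemannHypothesis_of_zetaScrew_nonneg`.

## Part 2: `RH ⇒ Ψ ≥ 0` and `Ψ(t) > 0` for `t ≠ 0` (§7.2)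

> "Suppose that the RH is true. Then all `γ` in (1.3) are real. Therefore, each term of the middle
> sum is non-negative. Also, for each `t > 0`, not all terms are simultaneously zero by
> Lemma 2.1. Hence `Ψ(t) > 0` for `t > 0`."

By Thm 1.1 (2), `Ψ(t) = Σ_ρ m(ρ)(cosh((ρ-½)t) - 1)/(ρ-½)²`; under RH `ρ - ½ = iγ` with
`γ = Im ρ ≠ 0` real, so the summand is `m(ρ)(1 - cos γt)/γ² ≥ 0` (`ZetaScrewThm17.hasSum_real`,
`zetaScrew_nonneg_of_RH`). For strictness Suzuki's Lemma 2.1 rests on Littlewood's theorem that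
the number of *distinct* zeros of `ξ(1/2 - z)` in `|z| ≤ r` is not `O(r)`, which the tree does not
have; we replace this one step by an elementary argument using only the definition (1.1)
(`ZetaScrewThm17.not_periodic`): if `Ψ(t₀) = 0` with `t₀ > 0`, every summand vanishes, so
`cos(γt₀) = 1` for every zero and hence `Ψ(t + t₀) = Ψ(t)` for all `t` (`periodic_of_eq_zero`).
But by (1.1), `Ψ = A - φ` on `[0, ∞)` with `A` the explicit smooth part and `φ` the prime sum,
which is affine on every interval on which `⌊e^t⌋` is constant; so the second difference
`A(t+2h) - 2A(t+h) + A(t)` would be `t₀`-periodic in `t` for small `h > 0`, whereas it is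
`4e^{t/2}(e^{h/2}-1)² + O(h² e^{-t/2})`, whose `t₀`-shift differs from it by
`≥ h²(e^{t/2}(e^{t₀/2} - 1) - 3) > 0` for large `t`. So the strictness clause, exactly as
printed, is obtained without Lemma 2.1.

Everything in this file is proved; there are no definitions and no named facts.

## References

* M. Suzuki, J. Lond. Math. Soc. (2) 108 (2023), no. 4, 1448–1487; arXiv:2206.03682, Thm 1.7,
  §7.2, Lemma 2.1, Thm 1.1. [Suzuki2023]
* D. V. Widder, *The Laplace Transform*, Princeton (1941), Ch. II §5, Thm 5b (Landau's theorem
  for Laplace transforms of non-negative functions — the "[Wi41]" of the paper). [Widder1941]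
* H. L. Montgomery, R. C. Vaughan, *Multiplicative Number Theory I*, CUP 2007, §15.1 Lemma 15.1.
  [MontgomeryVaughan2007]
-/

noncomputable section

open Complex Filter Topology Set MeasureTheory
open scoped Real

namespace Literature.NumberTheory.LFunctions

namespace ZetaScrewLandau

/-! ### The substitution `x = e^t` between `(1, ∞)` and `(0, ∞)` -/

/-- `∫_{(1,∞)} G(x) dx = ∫_{(0,∞)} e^t G(e^t) dt`. [folklore] -/
theorem integral_Ioi_one_eq_integral_Ioi_zero {E : Type*} [NormedAddCommGroup E] [NormedSpace ℝ E]
    (G : ℝ → E) :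
    ∫ x in Ioi (1 : ℝ), G x = ∫ t in Ioi (0 : ℝ), Real.exp t • G (Real.exp t) := by
  have himage : Real.exp '' Ioi (0 : ℝ) = Ioi 1 := by rw [Real.image_exp_Ioi, Real.exp_zero]
  have hderiv : ∀ x ∈ Ioi (0 : ℝ), HasDerivWithinAt Real.exp (Real.exp x) (Ioi 0) x :=
    fun x _ ↦ (Real.hasDerivAt_exp x).hasDerivWithinAt
  rw [← himage, integral_image_eq_integral_abs_deriv_smul measurableSet_Ioi hderiv
    Real.exp_injective.injOn]
  exact setIntegral_congr_fun measurableSet_Ioi fun t _ ↦ by rw [abs_of_pos (Real.exp_pos t)]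

/-- `G` is integrable on `(1,∞)` iff `t ↦ e^t G(e^t)` is integrable on `(0,∞)`. [folklore] -/
theorem integrableOn_Ioi_one_iff {E : Type*} [NormedAddCommGroup E] [NormedSpace ℝ E]
    (G : ℝ → E) :
    IntegrableOn G (Ioi 1) ↔ IntegrableOn (fun t : ℝ ↦ Real.exp t • G (Real.exp t)) (Ioi 0) := by
  have himage : Real.exp '' Ioi (0 : ℝ) = Ioi 1 := by rw [Real.image_exp_Ioi, Real.exp_zero]
  have hderiv : ∀ x ∈ Ioi (0 : ℝ), HasDerivWithinAt Real.exp (Real.exp x) (Ioi 0) x :=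
    fun x _ ↦ (Real.hasDerivAt_exp x).hasDerivWithinAt
  rw [← himage, integrableOn_image_iff_integrableOn_abs_deriv_smul measurableSet_Ioi hderiv
    Real.exp_injective.injOn]
  exact integrableOn_congr_fun (fun t _ ↦ by rw [abs_of_pos (Real.exp_pos t)]) measurableSet_Ioi

/-! ### The Mellin form of the Laplace transform of `Ψ` -/

/-- `(e^t)^w = e^{tw}` for real `t`, complex `w`. [folklore] -/
theorem ofReal_exp_cpow (t : ℝ) (w : ℂ) : ((Real.exp t : ℝ) : ℂ) ^ w = cexp (t * w) := by
  rw [cpow_def_of_ne_zero (by exact_mod_cast (Real.exp_pos t).ne'),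
    ← Complex.ofReal_log (Real.exp_pos t).le, Real.log_exp]

/-- **`∫_1^∞ Ψ(log x) x^{-(s+1)} dx = ∫_0^∞ Ψ(t) e^{-st} dt`** for every `s` (as Bochner integrals;
the substitution `x = e^t`). [folklore] -/
theorem mellinIoi_zetaScrew_log (s : ℂ) :
    Landau.mellinIoi (fun x ↦ zetaScrew (Real.log x)) s =
      ∫ t in Ioi (0 : ℝ), (zetaScrew t : ℂ) * cexp (-s * t) := by
  unfold Landau.mellinIoi
  rw [integral_Ioi_one_eq_integral_Ioi_zero]
  refine setIntegral_congr_fun measurableSet_Ioi fun t _ ↦ ?_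
  dsimp only
  rw [Real.log_exp, ofReal_exp_cpow, Complex.real_smul, Complex.ofReal_exp]
  have : cexp (t : ℂ) * cexp ((t : ℂ) * -(s + 1)) = cexp (-s * t) := by
    rw [← Complex.exp_add]
    congr 1
    ring
  rw [← this]
  ring

/-- Integrability transfers likewise (real `σ`): `Ψ(log x) x^{-(σ+1)} ∈ L¹(1,∞)` iff
`Ψ(t) e^{-σt} ∈ L¹(0,∞)`. [folklore] -/
theorem integrableOn_zetaScrew_log_iff (σ : ℝ) :
    IntegrableOn (fun x : ℝ ↦ zetaScrew (Real.log x) * x ^ (-(σ + 1))) (Ioi 1) ↔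
      IntegrableOn (fun t : ℝ ↦ zetaScrew t * Real.exp (-σ * t)) (Ioi 0) := by
  rw [integrableOn_Ioi_one_iff]
  refine integrableOn_congr_fun (fun t _ ↦ ?_) measurableSet_Ioi
  rw [smul_eq_mul, Real.log_exp, Real.rpow_def_of_pos (Real.exp_pos t), Real.log_exp]
  have : Real.exp t * Real.exp (t * -(σ + 1)) = Real.exp (-σ * t) := by
    rw [← Real.exp_add]
    congr 1
    ring
  rw [← this]
  ring

/-- For real `σ > 1/2`, `Ψ(t) e^{-σt}` is integrable on `(0, ∞)` (Thm 1.1 (1)), hence so is the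
Mellin integrand `Ψ(log x) x^{-(σ+1)}` on `(1, ∞)`. [cite: Suzuki2023, Thm 1.1 (1)] -/
theorem integrableOn_zetaScrew_log_rpow {σ : ℝ} (hσ : 1 / 2 < σ) :
    IntegrableOn (fun x : ℝ ↦ zetaScrew (Real.log x) * x ^ (-(σ + 1))) (Ioi 1) := by
  rw [integrableOn_zetaScrew_log_iff]
  have ha : (-(σ : ℂ)).re < -1 / 2 := by simp; linarith
  have h : IntegrableOn (fun t : ℝ ↦ ‖(zetaScrew t : ℂ) * cexp (-(σ : ℂ) * t)‖) (Ioi 0) :=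
    (ZetaScrewLaplace.integral_zetaScrew_mul_cexp ha).1.norm
  have hmeas : AEStronglyMeasurable (fun t : ℝ ↦ zetaScrew t * Real.exp (-σ * t))
      (volume.restrict (Ioi 0)) :=
    (continuous_zetaScrew.mul (Real.continuous_exp.comp (continuous_const.mul continuous_id))).aestronglyMeasurable
  refine (integrable_norm_iff hmeas).1 (h.congr_fun (fun t _ ↦ ?_) measurableSet_Ioi)
  dsimp only
  rw [norm_mul, norm_mul, Complex.norm_real, Real.norm_eq_abs,
    ZetaScrewLaplace.norm_cexp_mul_ofReal, Real.norm_of_nonneg (Real.exp_pos _).le]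
  simp

/-- On `Re s > 1/2` the Mellin transform is `R(s) = s^{-2} ξ'/ξ(1/2 + s)` (Thm 1.1 (1) with
`a = -s`). [cite: Suzuki2023, Thm 1.1 (1)] -/
theorem mellinIoi_eq_of_re_gt {s : ℂ} (hs : 1 / 2 < s.re) :
    Landau.mellinIoi (fun x ↦ zetaScrew (Real.log x)) s =
      1 / s ^ 2 * logDeriv riemannXi (1 / 2 + s) := by
  have ha : (-s).re < -1 / 2 := by simp; linarith
  rw [mellinIoi_zetaScrew_log, (ZetaScrewLaplace.integral_zetaScrew_mul_cexp ha).2]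
  simp [sub_neg_eq_add]

/-! ### `ξ(1/2 + w) ≠ 0` for `Re w > 0` under `Ψ ≥ 0` -/

/-- `ξ` has no zeros on the real axis. [folklore] -/
theorem riemannXi_half_add_ofReal_ne_zero (σ : ℝ) : riemannXi (1 / 2 + σ) ≠ 0 := by
  intro h
  have := (riemannXi_zero_prop h).2.2.2
  simp at this

/-- `R(s) = s^{-2} ξ'/ξ(1/2+s)` is differentiable at every `s ≠ 0` with `ξ(1/2+s) ≠ 0`. [folklore] -/
theorem differentiableAt_R {s : ℂ} (hs0 : s ≠ 0) (hξ : riemannXi (1 / 2 + s) ≠ 0) :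
    DifferentiableAt ℂ (fun s : ℂ ↦ 1 / s ^ 2 * logDeriv riemannXi (1 / 2 + s)) s := by
  have hlog : AnalyticAt ℂ (logDeriv riemannXi) (1 / 2 + s) := by
    have h : logDeriv riemannXi = fun z ↦ deriv riemannXi z / riemannXi z := by
      funext z; rw [logDeriv_apply]
    rw [h]
    exact (differentiable_riemannXi.analyticAt _).deriv.div (differentiable_riemannXi.analyticAt _) hξ
  have hcomp : DifferentiableAt ℂ (fun s : ℂ ↦ logDeriv riemannXi (1 / 2 + s)) s :=
    hlog.differentiableAt.comp s (by fun_prop)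
  refine DifferentiableAt.mul ?_ hcomp
  refine (differentiableAt_const _).div (by fun_prop) (pow_ne_zero 2 hs0)

/-- **No zeros of `ξ(1/2 + ·)` in the right half-plane if `Ψ ≥ 0`** (Suzuki2023 §7.2: Landau's
theorem for the Laplace transform of the non-negative function `Ψ`). [cite: Suzuki2023, §7.2 (proof of Thm 1.7)] -/
theorem riemannXi_ne_zero_of_zetaScrew_nonneg (hΨ : ∀ t, 0 ≤ zetaScrew t) {w₀ : ℂ}
    (hw₀ : 0 < w₀.re) : riemannXi (1 / 2 + w₀) ≠ 0 := by
  intro hzero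
  -- zeros of `ξ(1/2 + ·)` have real part `< 1/2`
  have hw₀' : w₀.re < 1 / 2 := by
    by_contra h
    exact riemannXi_ne_zero_of_one_le_re (by simp; linarith) hzero
  set g : ℝ → ℝ := fun x ↦ zetaScrew (Real.log x) with hg_def
  have hg : Measurable g := continuous_zetaScrew.measurable.comp Real.measurable_log
  set R : ℂ → ℂ := fun s ↦ 1 / s ^ 2 * logDeriv riemannXi (1 / 2 + s) with hR_def
  set ε : ℝ := w₀.re / 2 with hε_def
  have hε : 0 < ε := by positivity
  have hε1 : ε < 1 := by rw [hε_def]; linarith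
  -- a zero-free thin rectangle around the real segment `[ε/2, 3]`
  set K : Set ℂ := (fun σ : ℝ ↦ (σ : ℂ)) '' Icc (ε / 2) 3 with hK_def
  have hKc : IsCompact K := (isCompact_Icc.image Complex.continuous_ofReal)
  set U : Set ℂ := {s : ℂ | riemannXi (1 / 2 + s) ≠ 0} with hU_def
  have hUo : IsOpen U := by
    have : U = (fun s : ℂ ↦ riemannXi (1 / 2 + s)) ⁻¹' {0}ᶜ := rfl
    rw [this]
    exact isOpen_compl_singleton.preimage (differentiable_riemannXi.continuous.comp (by fun_prop))
  have hKU : K ⊆ U := by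
    rintro _ ⟨σ, _, rfl⟩
    exact riemannXi_half_add_ofReal_ne_zero σ
  obtain ⟨d₀, hd₀, hthick⟩ := hKc.exists_thickening_subset_open hUo hKU
  set W₀ : Set ℂ := {s : ℂ | ε / 2 < s.re ∧ s.re < 3 ∧ -d₀ < s.im ∧ s.im < d₀} with hW₀_def
  have hW₀eq : W₀ = {s : ℂ | ε / 2 < s.re} ∩ ({s : ℂ | s.re < 3} ∩ ({s : ℂ | -d₀ < s.im} ∩
      {s : ℂ | s.im < d₀})) := by
    ext s; simp [hW₀_def]
  have hW₀o : IsOpen W₀ := by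
    rw [hW₀eq]
    exact (isOpen_lt continuous_const Complex.continuous_re).inter
      ((isOpen_lt Complex.continuous_re continuous_const).inter
        ((isOpen_lt continuous_const Complex.continuous_im).inter
          (isOpen_lt Complex.continuous_im continuous_const)))
  have hW₀c : Convex ℝ W₀ := by
    rw [hW₀eq]
    exact (convex_halfSpace_re_gt _).inter ((convex_halfSpace_re_lt _).inter
      ((convex_halfSpace_im_gt _).inter (convex_halfSpace_im_lt _)))
  have hW₀U : W₀ ⊆ U := by
    intro s hs
    refine hthick (Metric.mem_thickening_iff.2 ⟨(s.re : ℂ), ⟨s.re, ⟨hs.1.le, hs.2.1.le⟩, rfl⟩, ?_⟩)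
    rw [dist_eq_norm]
    have : s - (s.re : ℂ) = (s.im : ℂ) * I := by
      apply Complex.ext <;> simp
    rw [this, norm_mul, Complex.norm_I, mul_one, Complex.norm_real, Real.norm_eq_abs, abs_lt]
    exact ⟨hs.2.2.1, hs.2.2.2⟩
  have hW₀r : ∀ σ : ℝ, ε < σ → σ ≤ 1 + 1 → (σ : ℂ) ∈ W₀ := by
    intro σ h1 h2
    simp only [hW₀_def, Set.mem_setOf_eq, ofReal_re, ofReal_im, neg_lt_zero]
    exact ⟨by linarith, by linarith, hd₀, hd₀⟩
  -- `R` is holomorphic on `{Re s > 1} ∪ W₀` and agrees with the transform on `Re s > 1`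
  have hΦ : DifferentiableOn ℂ R ({s : ℂ | 1 < s.re} ∪ W₀) := by
    intro s hs
    refine (differentiableAt_R ?_ ?_).differentiableWithinAt
    · intro h0
      rcases hs with hs | hs
      · simp only [Set.mem_setOf_eq, h0, zero_re] at hs; linarith
      · have := hs.1; rw [h0, zero_re] at this; linarith
    · rcases hs with hs | hs
      · exact riemannXi_ne_zero_of_one_le_re (by simp only [Set.mem_setOf_eq] at hs; simp; linarith)
      · exact hW₀U hs
  have hagree : EqOn R (Landau.mellinIoi g) {s : ℂ | 1 < s.re} := by
    intro s hs
    simp only [Set.mem_setOf_eq] at hs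
    exact (mellinIoi_eq_of_re_gt (by linarith)).symm
  have hint : IntegrableOn (fun x ↦ g x * x ^ (-((1 : ℝ) + 1))) (Ioi 1) :=
    integrableOn_zetaScrew_log_rpow (by norm_num)
  have hpos : ∀ x : ℝ, 1 < x → 0 ≤ g x := fun x _ ↦ hΨ _
  -- Landau: absolute convergence for every `σ > ε`, holomorphy of `F` on `Re s > ε`
  have hS : ∀ σ' : ℝ, ε < σ' → IntegrableOn (fun x ↦ g x * x ^ (-(σ' + 1))) (Ioi 1) :=
    fun σ' hσ' ↦ Landau.integrableOn_of_differentiableOn_union_convex hg hint le_rfl hpos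
      hε1 hW₀o hW₀c hW₀r hΦ hagree hσ'
  set F : ℂ → ℂ := Landau.mellinIoi g with hF_def
  have hFdiff : DifferentiableOn ℂ F {s : ℂ | ε < s.re} :=
    Landau.differentiableOn_mellinIoi_of_forall hg hS
  set H : Set ℂ := {s : ℂ | ε < s.re} with hH_def
  have hHo : IsOpen H := isOpen_lt continuous_const Complex.continuous_re
  have hHpre : IsPreconnected H := (convex_halfSpace_re_gt ε).isPreconnected
  -- the identity `F(s) s² ξ(1/2+s) = ξ'(1/2+s)` on `H`
  set Z : ℂ → ℂ := fun s ↦ riemannXi (1 / 2 + s) with hZ_def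
  have hZd : Differentiable ℂ Z := differentiable_riemannXi.comp (by fun_prop)
  have hZa : ∀ s, AnalyticAt ℂ Z s := fun s ↦ hZd.analyticAt s
  have hderivZ : ∀ s, deriv Z s = deriv riemannXi (1 / 2 + s) := fun s ↦ by
    simp only [hZ_def]
    exact deriv_comp_const_add riemannXi (1 / 2) s
  set G : ℂ → ℂ := fun s ↦ F s * s ^ 2 with hG_def
  have hGa : ∀ s ∈ H, AnalyticAt ℂ G s := fun s hs ↦
    ((hFdiff.analyticOnNhd hHo) s hs).mul ((analyticAt_id.pow 2))
  have hf₁ : AnalyticOnNhd ℂ (G * Z) H := fun s hs ↦ (hGa s hs).mul (hZa s)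
  have hf₂ : AnalyticOnNhd ℂ (deriv Z) H := fun s _ ↦ (hZa s).deriv
  have h2H : (2 : ℂ) ∈ H := by simp [hH_def]; linarith
  have hev2 : (G * Z) =ᶠ[𝓝 (2 : ℂ)] deriv Z := by
    have hopen : IsOpen {s : ℂ | 1 < s.re} := isOpen_lt continuous_const Complex.continuous_re
    filter_upwards [hopen.mem_nhds (show (2 : ℂ) ∈ {s : ℂ | 1 < s.re} by simp)] with s hs
    have hs' : 1 < s.re := hs
    have hξ : riemannXi (1 / 2 + s) ≠ 0 := riemannXi_ne_zero_of_one_le_re (by simp; linarith)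
    have hs0 : s ≠ 0 := fun h ↦ by rw [h, zero_re] at hs'; linarith
    rw [Pi.mul_apply, hderivZ s]
    simp only [hG_def, hZ_def]
    rw [← hagree hs]
    simp only [hR_def]
    rw [logDeriv_apply]
    set A : ℂ := deriv riemannXi (1 / 2 + s)
    set B : ℂ := riemannXi (1 / 2 + s)
    field_simp
  have hEqOn : EqOn (G * Z) (deriv Z) H := hf₁.eqOn_of_preconnected_of_eventuallyEq hf₂ hHpre h2H hev2
  -- orders at `w₀`
  have hw₀H : w₀ ∈ H := by simp [hH_def, hε_def]; linarith
  have hev : deriv Z =ᶠ[𝓝 w₀] G * Z := by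
    filter_upwards [hHo.mem_nhds hw₀H] with s hs
    exact (hEqOn hs).symm
  have hZ0 : Z w₀ = 0 := hzero
  have h1 : analyticOrderAt (deriv Z) w₀ + 1 = analyticOrderAt Z w₀ := by
    have := (hZa w₀).analyticOrderAt_deriv_add_one
    simpa [hZ0] using this
  have h2 : analyticOrderAt (deriv Z) w₀ = analyticOrderAt G w₀ + analyticOrderAt Z w₀ := by
    rw [analyticOrderAt_congr hev, analyticOrderAt_mul (hGa w₀ hw₀H) (hZa w₀)]
  rw [h2] at h1
  -- `Z` is not locally zero (else `ξ ≡ 0`), so its order is finite, contradiction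
  generalize hoZ : analyticOrderAt Z w₀ = oZ at h1
  generalize hoG : analyticOrderAt G w₀ = oG at h1
  cases oZ with
  | top =>
    have hloc : ∀ᶠ s in 𝓝 w₀, Z s = 0 := analyticOrderAt_eq_top.1 hoZ
    have hall : EqOn Z 0 univ :=
      (hZd.differentiableOn.analyticOnNhd isOpen_univ).eqOn_zero_of_preconnected_of_eventuallyEq_zero
        isPreconnected_univ (Set.mem_univ w₀) hloc
    have h1' : Z 1 = 0 := hall (Set.mem_univ 1)
    simp only [hZ_def] at h1'
    exact riemannXi_ne_zero_of_one_le_re (s := 1 / 2 + 1) (by norm_num) h1'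
  | coe n =>
    cases oG with
    | top => simp at h1
    | coe m =>
      have h' : (m + n + 1 : ℕ) = n := by exact_mod_cast h1
      omega

end ZetaScrewLandau

/-- **Suzuki2023 Thm 1.7, sufficiency: if `Ψ(t) ≥ 0` for all real `t`, the Riemann hypothesis
holds.** (`Ψ = zetaScrew`; proof: `ZetaScrewLandau.riemannXi_ne_zero_of_zetaScrew_nonneg` gives
no zeros of `ζ` with `1/2 < Re s < 1`, i.e. `QuasiRiemannHypothesis (1/2)`, which is RH by the
functional equation, `quasiRiemannHypothesis_one_half_iff_holds`.) [cite: Suzuki2023, Thm 1.7] -/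
theorem riemannHypothesis_of_zetaScrew_nonneg (hΨ : ∀ t : ℝ, 0 ≤ zetaScrew t) :
    RiemannHypothesis := by
  refine quasiRiemannHypothesis_one_half_iff_holds.1 fun s hs h1 h2 ↦ ?_
  have hξ : riemannXi s = 0 := (riemannXi_eq_zero_iff_holds s).2 ⟨hs, by linarith, h2⟩
  have hw : 0 < (s - 1 / 2).re := by simp; linarith
  refine ZetaScrewLandau.riemannXi_ne_zero_of_zetaScrew_nonneg hΨ hw ?_
  rw [show (1 / 2 : ℂ) + (s - 1 / 2) = s by ring]
  exact hξ

namespace ZetaScrewThm17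

open ZetaZeros.riemannZetaNontrivialZeros

/-! ### RH ⇒ `Ψ ≥ 0` via the series over the zeros -/

/-- Under RH every non-trivial zero has real part `1/2`. [folklore] -/
theorem re_eq_half_of_RH (hRH : RiemannHypothesis) {ρ : ℂ}
    (hρ : ρ ∈ ZetaZeros.riemannZetaNontrivialZeros) : ρ.re = 1 / 2 := by
  refine hRH ρ (zeta_eq_zero hρ) ?_ (ne_one hρ)
  rintro ⟨n, hn⟩
  have h := re_pos hρ
  rw [hn] at h
  simp at h
  linarith [(Nat.cast_nonneg n : (0 : ℝ) ≤ n)]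

/-- Under RH, `ρ - 1/2 = iγ` with `γ = Im ρ`. [folklore] -/
theorem sub_half_eq_of_RH (hRH : RiemannHypothesis) {ρ : ℂ}
    (hρ : ρ ∈ ZetaZeros.riemannZetaNontrivialZeros) : ρ - 1 / 2 = (ρ.im : ℂ) * I := by
  apply Complex.ext
  · simp [re_eq_half_of_RH hRH hρ]
  · simp

/-- Under RH the complex summand of Thm 1.1 (2) is the real number `m(ρ)(1 - cos γt)/γ²`. [cite: Suzuki2023, §7.2] -/
theorem term_eq_ofReal_of_RH (hRH : RiemannHypothesis) (ρ : ZetaZeros.riemannZetaNontrivialZeros)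
    (t : ℝ) :
    (riemannZetaZeroOrder (ρ : ℂ) : ℂ) *
        ((Complex.cosh (((ρ : ℂ) - 1 / 2) * t) - 1) / ((ρ : ℂ) - 1 / 2) ^ 2) =
      ((((riemannZetaZeroOrder (ρ : ℂ) : ℝ) * ((1 - Real.cos ((ρ : ℂ).im * t)) / (ρ : ℂ).im ^ 2)) : ℝ) : ℂ) := by
  have hγ : (ρ : ℂ).im ≠ 0 := im_ne_zero ρ.2
  have hγ' : ((ρ : ℂ).im : ℂ) ≠ 0 := Complex.ofReal_ne_zero.2 hγ
  rw [sub_half_eq_of_RH hRH ρ.2]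
  have hcosh : Complex.cosh (((ρ : ℂ).im : ℂ) * I * t) = (Real.cos ((ρ : ℂ).im * t) : ℂ) := by
    rw [show ((ρ : ℂ).im : ℂ) * I * t = (((ρ : ℂ).im * t : ℝ) : ℂ) * I by push_cast; ring,
      Complex.cosh_mul_I, Complex.ofReal_cos]
  rw [hcosh]
  push_cast
  have hI : (((ρ : ℂ).im : ℂ) * I) ^ 2 = -((ρ : ℂ).im : ℂ) ^ 2 := by rw [mul_pow, I_sq]; ring
  rw [hI]
  field_simp
  ring

/-- **RH ⇒ `Ψ(t) = Σ_ρ m(ρ)(1 - cos γt)/γ²`** as a series of non-negative reals (Thm 1.1 (2) read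
under RH). [cite: Suzuki2023, §7.2] -/
theorem hasSum_real (hRH : RiemannHypothesis) (t : ℝ) :
    HasSum (fun ρ : ZetaZeros.riemannZetaNontrivialZeros ↦
      (riemannZetaZeroOrder (ρ : ℂ) : ℝ) * ((1 - Real.cos ((ρ : ℂ).im * t)) / (ρ : ℂ).im ^ 2)) (zetaScrew t) := by
  have h := Suzuki2023_thm11_series_of_fourier Suzuki2023_thm11_fourier_holds t
  have h' : HasSum (fun ρ : ZetaZeros.riemannZetaNontrivialZeros ↦
      ((((riemannZetaZeroOrder (ρ : ℂ) : ℝ) * ((1 - Real.cos ((ρ : ℂ).im * t)) / (ρ : ℂ).im ^ 2)) : ℝ) : ℂ)) (zetaScrew t : ℂ) :=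
    h.congr_fun fun ρ ↦ (term_eq_ofReal_of_RH hRH ρ t).symm
  exact Complex.hasSum_ofReal.1 h'

/-- The real summands are non-negative. [folklore] -/
theorem realTerm_nonneg (ρ : ZetaZeros.riemannZetaNontrivialZeros) (t : ℝ) :
    0 ≤ (riemannZetaZeroOrder (ρ : ℂ) : ℝ) * ((1 - Real.cos ((ρ : ℂ).im * t)) / (ρ : ℂ).im ^ 2) := by
  have h1 := one_le_order ρ.2
  refine mul_nonneg (by exact_mod_cast (show (0 : ℤ) ≤ riemannZetaZeroOrder (ρ : ℂ) by omega)) ?_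
  exact div_nonneg (by linarith [Real.cos_le_one ((ρ : ℂ).im * t)]) (sq_nonneg _)

/-- **RH ⇒ `Ψ ≥ 0`** (Suzuki2023 Thm 1.7, necessity). [cite: Suzuki2023, Thm 1.7] -/
theorem zetaScrew_nonneg_of_RH (hRH : RiemannHypothesis) (t : ℝ) : 0 ≤ zetaScrew t :=
  (hasSum_real hRH t).nonneg fun ρ ↦ realTerm_nonneg ρ t

/-! ### A zero of `Ψ` forces periodicity -/

/-- If RH holds and `Ψ(t₀) = 0`, then `cos(γ t₀) = 1` for every zero, hence
`Ψ(t + t₀) = Ψ(t)` for all `t`. [cite: Suzuki2023, §7.2] -/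
theorem periodic_of_eq_zero (hRH : RiemannHypothesis) {t₀ : ℝ} (h0 : zetaScrew t₀ = 0) (t : ℝ) :
    zetaScrew (t + t₀) = zetaScrew t := by
  have hzero : (fun ρ : ZetaZeros.riemannZetaNontrivialZeros ↦
      (riemannZetaZeroOrder (ρ : ℂ) : ℝ) * ((1 - Real.cos ((ρ : ℂ).im * t₀)) / (ρ : ℂ).im ^ 2)) = 0 := by
    have h := hasSum_real hRH t₀
    rw [h0] at h
    exact (hasSum_zero_iff_of_nonneg fun ρ ↦ realTerm_nonneg ρ t₀).1 h
  have hcos : ∀ ρ : ZetaZeros.riemannZetaNontrivialZeros, Real.cos ((ρ : ℂ).im * t₀) = 1 := by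
    intro ρ
    have h := congrFun hzero ρ
    simp only [Pi.zero_apply, mul_eq_zero, div_eq_zero_iff] at h
    have hm : (riemannZetaZeroOrder (ρ : ℂ) : ℝ) ≠ 0 := by
      have := one_le_order ρ.2
      exact_mod_cast (by omega : riemannZetaZeroOrder (ρ : ℂ) ≠ 0)
    have hγ : (ρ : ℂ).im ^ 2 ≠ 0 := pow_ne_zero 2 (im_ne_zero ρ.2)
    rcases h with h | h | h
    · exact (hm h).elim
    · linarith
    · exact (hγ h).elim
  have hterm : ∀ ρ : ZetaZeros.riemannZetaNontrivialZeros,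
      (riemannZetaZeroOrder (ρ : ℂ) : ℝ) * ((1 - Real.cos ((ρ : ℂ).im * (t + t₀))) / (ρ : ℂ).im ^ 2) =
      (riemannZetaZeroOrder (ρ : ℂ) : ℝ) * ((1 - Real.cos ((ρ : ℂ).im * t)) / (ρ : ℂ).im ^ 2) := by
    intro ρ
    have hc := hcos ρ
    have hs : Real.sin ((ρ : ℂ).im * t₀) = 0 := Real.sin_eq_zero_iff_cos_eq.2 (Or.inl hc)
    simp only [mul_add, Real.cos_add, hc, hs, mul_one, mul_zero, sub_zero]
  have h1 := hasSum_real hRH (t + t₀)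
  simp_rw [hterm] at h1
  exact h1.unique (hasSum_real hRH t)

/-! ### `Ψ` is not periodic: the explicit part of (1.1) against the prime sum -/

/-- The Hurwitz–Lerch piece `E(s) = e^{-s/2} Φ(e^{-2s},2,¼)` as a single series for `s ≥ 0`:
`E(s) = Σ_k e^{-(2k+½)s}/(k+¼)²`. [cite: Suzuki2023, §2.1] -/
theorem hasSum_E {s : ℝ} (hs : 0 ≤ s) :
    HasSum (fun k : ℕ ↦ Real.exp (-((2 * k + 1 / 2) * s)) / ((k : ℝ) + 1 / 4) ^ 2)
      (Real.exp (-(s / 2)) * hurwitzLerchQuarter s) := by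
  have h := ((summable_hurwitzLerchQuarter s).hasSum).mul_left (Real.exp (-(s / 2)))
  refine h.congr_fun fun k ↦ ?_
  rw [abs_of_nonneg hs, ← mul_div_assoc, ← Real.exp_add]
  congr 2
  ring

/-- Summability of the termwise series of `E`. [folklore] -/
theorem summable_E {s : ℝ} (hs : 0 ≤ s) :
    Summable fun k : ℕ ↦ Real.exp (-((2 * k + 1 / 2) * s)) / ((k : ℝ) + 1 / 4) ^ 2 :=
  (hasSum_E hs).summable

/-- The second difference of `E` at `s ≥ 0` with step `h ≥ 0`:
`E(s+2h) - 2E(s+h) + E(s) = Σ_k e^{-c_k s}(e^{-c_k h} - 1)²/(k+¼)²`, `c_k = 2k + ½`. [folklore] -/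
theorem secondDiff_E {s h : ℝ} (hs : 0 ≤ s) (hh : 0 ≤ h) :
    HasSum (fun k : ℕ ↦ Real.exp (-((2 * k + 1 / 2) * s)) *
        (Real.exp (-((2 * k + 1 / 2) * h)) - 1) ^ 2 / ((k : ℝ) + 1 / 4) ^ 2)
      (Real.exp (-((s + 2 * h) / 2)) * hurwitzLerchQuarter (s + 2 * h)
        - 2 * (Real.exp (-((s + h) / 2)) * hurwitzLerchQuarter (s + h))
        + Real.exp (-(s / 2)) * hurwitzLerchQuarter s) := by
  have h2 := hasSum_E (show 0 ≤ s + 2 * h by linarith)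
  have h1 := (hasSum_E (show 0 ≤ s + h by linarith)).mul_left 2
  have h0 := hasSum_E hs
  refine ((h2.sub h1).add h0).congr_fun fun k ↦ ?_
  have e2 : Real.exp (-((2 * k + 1 / 2) * (s + 2 * h))) =
      Real.exp (-((2 * k + 1 / 2) * s)) * Real.exp (-((2 * k + 1 / 2) * h)) ^ 2 := by
    rw [sq, ← Real.exp_add, ← Real.exp_add]; congr 1; ring
  have e1 : Real.exp (-((2 * k + 1 / 2) * (s + h))) =
      Real.exp (-((2 * k + 1 / 2) * s)) * Real.exp (-((2 * k + 1 / 2) * h)) := by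
    rw [← Real.exp_add]; congr 1; ring
  rw [e2, e1]
  ring

/-- `(e^{-x} - 1)² ≤ x²` for `x ≥ 0`. [folklore] -/
theorem sq_exp_neg_sub_one_le {x : ℝ} (hx : 0 ≤ x) : (Real.exp (-x) - 1) ^ 2 ≤ x ^ 2 := by
  have h1 : Real.exp (-x) ≤ 1 := by rw [Real.exp_le_one_iff]; linarith
  have h2 : 1 - x ≤ Real.exp (-x) := by linarith [Real.add_one_le_exp (-x)]
  have h3 : 0 ≤ 1 - Real.exp (-x) := by linarith
  nlinarith

/-- `(e^{x} - 1)² ≥ x²` for `x ≥ 0`. [folklore] -/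
theorem sq_le_sq_exp_sub_one {x : ℝ} (hx : 0 ≤ x) : x ^ 2 ≤ (Real.exp x - 1) ^ 2 := by
  have h := Real.add_one_le_exp x
  nlinarith

/-- The second difference of `E` is `≥ 0` and `≤ 8h² e^{-s/2}` for `s ≥ 1`, `h ≥ 0`. [folklore] -/
theorem secondDiff_E_bounds {s h : ℝ} (hs : 1 ≤ s) (hh : 0 ≤ h) :
    0 ≤ Real.exp (-((s + 2 * h) / 2)) * hurwitzLerchQuarter (s + 2 * h)
        - 2 * (Real.exp (-((s + h) / 2)) * hurwitzLerchQuarter (s + h))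
        + Real.exp (-(s / 2)) * hurwitzLerchQuarter s ∧
      Real.exp (-((s + 2 * h) / 2)) * hurwitzLerchQuarter (s + 2 * h)
        - 2 * (Real.exp (-((s + h) / 2)) * hurwitzLerchQuarter (s + h))
        + Real.exp (-(s / 2)) * hurwitzLerchQuarter s ≤ 8 * h ^ 2 * Real.exp (-(s / 2)) := by
  have hs0 : 0 ≤ s := by linarith
  have H := secondDiff_E hs0 hh
  have hnonneg : ∀ k : ℕ, 0 ≤ Real.exp (-((2 * k + 1 / 2) * s)) *
      (Real.exp (-((2 * k + 1 / 2) * h)) - 1) ^ 2 / ((k : ℝ) + 1 / 4) ^ 2 := fun k ↦ by positivity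
  refine ⟨H.nonneg hnonneg, ?_⟩
  -- termwise: `≤ 4h² e^{-s/2} (e^{-2s})^k`
  set r : ℝ := Real.exp (-(2 * s)) with hr
  have hr0 : 0 ≤ r := (Real.exp_pos _).le
  have hr1 : r ≤ 1 / 2 := by
    have h3 : (2 : ℝ) ≤ Real.exp (2 * s) := by
      have := Real.add_one_le_exp (2 * s); linarith
    rw [hr, Real.exp_neg, inv_eq_one_div, div_le_div_iff₀ (Real.exp_pos _) two_pos]
    linarith
  have hterm : ∀ k : ℕ, Real.exp (-((2 * k + 1 / 2) * s)) *
      (Real.exp (-((2 * k + 1 / 2) * h)) - 1) ^ 2 / ((k : ℝ) + 1 / 4) ^ 2 ≤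
      4 * h ^ 2 * Real.exp (-(s / 2)) * r ^ k := by
    intro k
    have hk : (0 : ℝ) < (k : ℝ) + 1 / 4 := by positivity
    have hc : (0 : ℝ) ≤ (2 * k + 1 / 2) * h := by positivity
    have h1 := sq_exp_neg_sub_one_le hc
    have hexp : Real.exp (-((2 * k + 1 / 2) * s)) = Real.exp (-(s / 2)) * r ^ k := by
      rw [hr, ← Real.exp_nat_mul, ← Real.exp_add]; congr 1; ring
    rw [hexp, div_le_iff₀ (by positivity)]
    have : ((2 * k + 1 / 2) * h) ^ 2 = 4 * h ^ 2 * ((k : ℝ) + 1 / 4) ^ 2 := by ring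
    rw [this] at h1
    have hpos : 0 ≤ Real.exp (-(s / 2)) * r ^ k := by positivity
    nlinarith
  have hgeom : HasSum (fun k : ℕ ↦ 4 * h ^ 2 * Real.exp (-(s / 2)) * r ^ k)
      (4 * h ^ 2 * Real.exp (-(s / 2)) * (1 - r)⁻¹) :=
    (hasSum_geometric_of_lt_one hr0 (by linarith)).mul_left _
  refine (hasSum_le hterm H hgeom).trans ?_
  have hinv : (1 - r)⁻¹ ≤ 2 := by
    rw [inv_eq_one_div, div_le_iff₀ (by linarith)]; linarith
  have : 0 ≤ 4 * h ^ 2 * Real.exp (-(s / 2)) := by positivity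
  nlinarith

/-- The prime sum on an interval of constancy of `⌊e^s⌋`: for `s ≥ 0` with `⌊e^s⌋ = N`,
`φ(s) = s Σ_{n ≤ N} Λ(n)/√n - Σ_{n ≤ N} Λ(n) log n/√n` (affine in `s`). [cite: Suzuki2023, (1.1)] -/
theorem zetaScrewPrimeSum_eq_affine {s : ℝ} (hs : 0 ≤ s) {N : ℕ} (hN : ⌊Real.exp s⌋₊ = N) :
    zetaScrewPrimeSum s =
      s * (∑ n ∈ Finset.Icc 1 N, ArithmeticFunction.vonMangoldt n / Real.sqrt n)
        - ∑ n ∈ Finset.Icc 1 N, ArithmeticFunction.vonMangoldt n / Real.sqrt n * Real.log n := by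
  unfold zetaScrewPrimeSum
  rw [abs_of_nonneg hs, hN, Finset.mul_sum, ← Finset.sum_sub_distrib]
  refine Finset.sum_congr rfl fun n _ ↦ ?_
  ring

/-- `⌊e^s⌋` is constant on `[t, t + 2h]` for `0 < h` small (`e^{t+2h} < ⌊e^t⌋ + 1`). [folklore] -/
theorem floor_exp_eq_of_mem {t h s : ℝ} (h2 : Real.exp (t + 2 * h) < (⌊Real.exp t⌋₊ : ℝ) + 1)
    (hs : s ∈ Icc t (t + 2 * h)) : ⌊Real.exp s⌋₊ = ⌊Real.exp t⌋₊ := by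
  rw [Nat.floor_eq_iff (Real.exp_pos s).le]
  constructor
  · exact (Nat.floor_le (Real.exp_pos t).le).trans (Real.exp_le_exp.2 hs.1)
  · exact (Real.exp_le_exp.2 hs.2).trans_lt h2

/-- Existence of a common step: for `t, t'` there is `h > 0` with `⌊e^s⌋` constant on
`[t, t+2h]` and on `[t', t'+2h]`. [folklore] -/
theorem exists_step (t t' : ℝ) : ∃ h : ℝ, 0 < h ∧
    Real.exp (t + 2 * h) < (⌊Real.exp t⌋₊ : ℝ) + 1 ∧
    Real.exp (t' + 2 * h) < (⌊Real.exp t'⌋₊ : ℝ) + 1 := by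
  have g1 : t < Real.log ((⌊Real.exp t⌋₊ : ℝ) + 1) := by
    rw [Real.lt_log_iff_exp_lt (by positivity)]; exact Nat.lt_floor_add_one _
  have g2 : t' < Real.log ((⌊Real.exp t'⌋₊ : ℝ) + 1) := by
    rw [Real.lt_log_iff_exp_lt (by positivity)]; exact Nat.lt_floor_add_one _
  set h : ℝ := min (Real.log ((⌊Real.exp t⌋₊ : ℝ) + 1) - t) (Real.log ((⌊Real.exp t'⌋₊ : ℝ) + 1) - t') / 4
    with hh
  have hmin1 := min_le_left (Real.log ((⌊Real.exp t⌋₊ : ℝ) + 1) - t)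
    (Real.log ((⌊Real.exp t'⌋₊ : ℝ) + 1) - t')
  have hmin2 := min_le_right (Real.log ((⌊Real.exp t⌋₊ : ℝ) + 1) - t)
    (Real.log ((⌊Real.exp t'⌋₊ : ℝ) + 1) - t')
  refine ⟨h, ?_, ?_, ?_⟩
  · rw [hh]
    have : 0 < min (Real.log ((⌊Real.exp t⌋₊ : ℝ) + 1) - t) (Real.log ((⌊Real.exp t'⌋₊ : ℝ) + 1) - t') :=
      lt_min (by linarith) (by linarith)
    linarith
  · rw [← Real.lt_log_iff_exp_lt (by positivity)]
    rw [hh]; linarith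
  · rw [← Real.lt_log_iff_exp_lt (by positivity)]
    rw [hh]; linarith

/-- **`Ψ` is not periodic.** If `t₀ > 0` then `Ψ(t + t₀) = Ψ(t)` cannot hold for all `t`:
second differences of the explicit part of (1.1) grow like `e^{t/2}` while the prime sum is
locally affine. [cite: Suzuki2023, (1.1)] -/
theorem not_periodic {t₀ : ℝ} (ht₀ : 0 < t₀) (hper : ∀ t, zetaScrew (t + t₀) = zetaScrew t) :
    False := by
  -- the constants of (1.1)
  set κ : ℝ := Real.eulerMascheroniConstant + Real.pi / 2 + 3 * Real.log 2 + Real.log Real.pi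
    with hκ
  set C : ℝ := ∑' k : ℕ, 1 / ((k : ℝ) + 1 / 4) ^ 2 with hC
  set E : ℝ → ℝ := fun s ↦ Real.exp (-(s / 2)) * hurwitzLerchQuarter s with hE
  set A : ℝ → ℝ := fun s ↦ 4 * (Real.exp (s / 2) + Real.exp (-(s / 2)) - 2) - s / 2 * κ
    + (1 / 4) * (C - E s) with hA
  have hΨ : ∀ s, 0 ≤ s → zetaScrew s = A s - zetaScrewPrimeSum s := by
    intro s hs
    rw [zetaScrew_eq, abs_of_nonneg hs]
    simp only [hA, hE, hκ, hC]
    ring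
  -- a large `t ≥ 1`
  have hgrow : 0 < Real.exp (t₀ / 2) - 1 := by
    have : 1 < Real.exp (t₀ / 2) := Real.one_lt_exp_iff.2 (by positivity)
    linarith
  obtain ⟨t, ht1, hbig⟩ : ∃ t : ℝ, 1 ≤ t ∧ 6 < Real.exp (t / 2) * (Real.exp (t₀ / 2) - 1) := by
    have hlim : Tendsto (fun t : ℝ ↦ Real.exp (t / 2) * (Real.exp (t₀ / 2) - 1)) atTop atTop :=
      (Real.tendsto_exp_atTop.comp (tendsto_id.atTop_div_const (by norm_num : (0 : ℝ) < 2))).atTop_mul_const hgrow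
    obtain ⟨t, ht⟩ := ((eventually_ge_atTop (1 : ℝ)).and (hlim.eventually_gt_atTop 6)).exists
    exact ⟨t, ht.1, ht.2⟩
  have ht0 : 0 ≤ t := by linarith
  -- a common step `h`
  obtain ⟨h, hh, hstep1, hstep2⟩ := exists_step t (t + t₀)
  set N₁ : ℕ := ⌊Real.exp t⌋₊ with hN₁
  set N₂ : ℕ := ⌊Real.exp (t + t₀)⌋₊ with hN₂
  -- the prime sum is affine on both windows: second differences vanish
  set P₁ : ℝ := ∑ n ∈ Finset.Icc 1 N₁, ArithmeticFunction.vonMangoldt n / Real.sqrt n with hP₁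
  set Q₁ : ℝ := ∑ n ∈ Finset.Icc 1 N₁, ArithmeticFunction.vonMangoldt n / Real.sqrt n * Real.log n with hQ₁
  set P₂ : ℝ := ∑ n ∈ Finset.Icc 1 N₂, ArithmeticFunction.vonMangoldt n / Real.sqrt n with hP₂
  set Q₂ : ℝ := ∑ n ∈ Finset.Icc 1 N₂, ArithmeticFunction.vonMangoldt n / Real.sqrt n * Real.log n with hQ₂
  have hφ₁ : ∀ s ∈ Icc t (t + 2 * h), zetaScrewPrimeSum s = s * P₁ - Q₁ := fun s hs ↦
    zetaScrewPrimeSum_eq_affine (ht0.trans hs.1) (floor_exp_eq_of_mem hstep1 hs)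
  have hφ₂ : ∀ s ∈ Icc (t + t₀) (t + t₀ + 2 * h), zetaScrewPrimeSum s = s * P₂ - Q₂ := fun s hs ↦
    zetaScrewPrimeSum_eq_affine (by linarith [hs.1]) (floor_exp_eq_of_mem hstep2 hs)
  have m1 : t ∈ Icc t (t + 2 * h) := ⟨le_rfl, by linarith⟩
  have m2 : t + h ∈ Icc t (t + 2 * h) := ⟨by linarith, by linarith⟩
  have m3 : t + 2 * h ∈ Icc t (t + 2 * h) := ⟨by linarith, le_rfl⟩
  have n1 : t + t₀ ∈ Icc (t + t₀) (t + t₀ + 2 * h) := ⟨le_rfl, by linarith⟩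
  have n2 : t + h + t₀ ∈ Icc (t + t₀) (t + t₀ + 2 * h) := ⟨by linarith, by linarith⟩
  have n3 : t + 2 * h + t₀ ∈ Icc (t + t₀) (t + t₀ + 2 * h) := ⟨by linarith, by linarith⟩
  -- second differences of `Ψ` at `t` and at `t + t₀` coincide (periodicity) ...
  have hD : A (t + 2 * h + t₀) - 2 * A (t + h + t₀) + A (t + t₀)
      = A (t + 2 * h) - 2 * A (t + h) + A t := by
    have e1 := hper t
    have e2 := hper (t + h)
    have e3 := hper (t + 2 * h)
    rw [hΨ _ (by linarith), hΨ _ (by linarith), hφ₂ _ n1, hφ₁ _ m1] at e1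
    rw [hΨ _ (by linarith), hΨ _ (by linarith), hφ₂ _ n2, hφ₁ _ m2] at e2
    rw [hΨ _ (by linarith), hΨ _ (by linarith), hφ₂ _ n3, hφ₁ _ m3] at e3
    linear_combination e3 - 2 * e2 + e1
  -- ... but the explicit part says otherwise
  have hexp : ∀ s : ℝ, A (s + 2 * h) - 2 * A (s + h) + A s =
      4 * (Real.exp (s / 2) * (Real.exp (h / 2) - 1) ^ 2)
      + 4 * (Real.exp (-(s / 2)) * (Real.exp (-(h / 2)) - 1) ^ 2)
      - (1 / 4) * (E (s + 2 * h) - 2 * E (s + h) + E s) := by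
    intro s
    simp only [hA]
    have a1 : Real.exp ((s + 2 * h) / 2) = Real.exp (s / 2) * Real.exp (h / 2) ^ 2 := by
      rw [sq, ← Real.exp_add, ← Real.exp_add]; congr 1; ring
    have a2 : Real.exp ((s + h) / 2) = Real.exp (s / 2) * Real.exp (h / 2) := by
      rw [← Real.exp_add]; congr 1; ring
    have a3 : Real.exp (-((s + 2 * h) / 2)) = Real.exp (-(s / 2)) * Real.exp (-(h / 2)) ^ 2 := by
      rw [sq, ← Real.exp_add, ← Real.exp_add]; congr 1; ring
    have a4 : Real.exp (-((s + h) / 2)) = Real.exp (-(s / 2)) * Real.exp (-(h / 2)) := by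
      rw [← Real.exp_add]; congr 1; ring
    rw [a1, a2, a3, a4]
    ring
  have hEt : E (t + 2 * h) - 2 * E (t + h) + E t =
      Real.exp (-((t + 2 * h) / 2)) * hurwitzLerchQuarter (t + 2 * h)
        - 2 * (Real.exp (-((t + h) / 2)) * hurwitzLerchQuarter (t + h))
        + Real.exp (-(t / 2)) * hurwitzLerchQuarter t := by simp only [hE]
  have hEt' : E (t + t₀ + 2 * h) - 2 * E (t + t₀ + h) + E (t + t₀) =
      Real.exp (-((t + t₀ + 2 * h) / 2)) * hurwitzLerchQuarter (t + t₀ + 2 * h)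
        - 2 * (Real.exp (-((t + t₀ + h) / 2)) * hurwitzLerchQuarter (t + t₀ + h))
        + Real.exp (-((t + t₀) / 2)) * hurwitzLerchQuarter (t + t₀) := by simp only [hE]
  obtain ⟨b1, b2⟩ := secondDiff_E_bounds ht1 hh.le
  obtain ⟨b3, b4⟩ := secondDiff_E_bounds (show 1 ≤ t + t₀ by linarith) hh.le
  rw [← hEt] at b1 b2
  rw [← hEt'] at b3 b4
  have hD' : A (t + t₀ + 2 * h) - 2 * A (t + t₀ + h) + A (t + t₀)
      = A (t + 2 * h) - 2 * A (t + h) + A t := by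
    rw [show t + t₀ + 2 * h = t + 2 * h + t₀ by ring, show t + t₀ + h = t + h + t₀ by ring]
    exact hD
  rw [hexp (t + t₀), hexp t] at hD'
  -- bounds for the elementary factors, and the final (linear) bookkeeping
  have e_tt0 : Real.exp ((t + t₀) / 2) = Real.exp (t / 2) * Real.exp (t₀ / 2) := by
    rw [← Real.exp_add]; congr 1; ring
  rw [e_tt0] at hD'
  set X : ℝ := Real.exp (t / 2) with hX
  set Y : ℝ := Real.exp (t₀ / 2) with hY
  set p : ℝ := (Real.exp (h / 2) - 1) ^ 2 with hp_def
  set q : ℝ := (Real.exp (-(h / 2)) - 1) ^ 2 with hq_def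
  set u : ℝ := Real.exp (-((t + t₀) / 2)) with hu
  set v : ℝ := Real.exp (-(t / 2)) with hv
  set D₁ : ℝ := E (t + t₀ + 2 * h) - 2 * E (t + t₀ + h) + E (t + t₀) with hD₁
  set D₀ : ℝ := E (t + 2 * h) - 2 * E (t + h) + E t with hD₀
  have hXpos : 0 < X := Real.exp_pos _
  have hY1 : 0 < Y - 1 := hgrow
  have hp : (h / 2) ^ 2 ≤ p := sq_le_sq_exp_sub_one (by linarith)
  have hq : q ≤ (h / 2) ^ 2 := sq_exp_neg_sub_one_le (by linarith)
  have hq0 : 0 ≤ q := sq_nonneg _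
  have hu0 : 0 ≤ u := (Real.exp_pos _).le
  have hv0 : 0 ≤ v := (Real.exp_pos _).le
  have huv : u ≤ v := Real.exp_le_exp.2 (by linarith)
  have hv1 : v ≤ 1 := by rw [hv, Real.exp_le_one_iff]; linarith
  have hh2 : 0 < h ^ 2 := by positivity
  -- from `hD'`: `4 X (Y-1) p = 4 v q - 4 u q - D₀/4 + D₁/4`
  have key : 4 * X * (Y - 1) * p = 4 * (v * q) - 4 * (u * q) - (1 / 4) * D₀ + (1 / 4) * D₁ := by
    linear_combination hD'
  have s1 : 4 * X * (Y - 1) * ((h / 2) ^ 2) ≤ 4 * X * (Y - 1) * p :=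
    mul_le_mul_of_nonneg_left hp (by positivity)
  have s2 : v * q ≤ v * (h / 2) ^ 2 := mul_le_mul_of_nonneg_left hq hv0
  have s3 : 0 ≤ u * q := mul_nonneg hu0 hq0
  have s4 : h ^ 2 * u ≤ h ^ 2 * v := mul_le_mul_of_nonneg_left huv hh2.le
  have s5 : h ^ 2 * v ≤ h ^ 2 := mul_le_of_le_one_right hh2.le hv1
  have s6 : 6 * h ^ 2 < h ^ 2 * (X * (Y - 1)) := by
    have := mul_lt_mul_of_pos_left hbig hh2
    linarith
  have s7 : h ^ 2 * (X * (Y - 1)) = 4 * X * (Y - 1) * ((h / 2) ^ 2) := by ring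
  have s8 : v * (h / 2) ^ 2 = (h ^ 2 * v) / 4 := by ring
  rw [s7] at s6
  rw [s8] at s2
  linarith

/-- **RH ⇒ `Ψ(t) > 0` for `t ≠ 0`** (Suzuki2023 Thm 1.7, the "Further" clause; here without
Lemma 2.1). [cite: Suzuki2023, Thm 1.7] -/
theorem zetaScrew_pos_of_RH (hRH : RiemannHypothesis) {t : ℝ} (ht : t ≠ 0) : 0 < zetaScrew t := by
  have key : ∀ s : ℝ, 0 < s → 0 < zetaScrew s := fun s hs ↦
    lt_of_le_of_ne (zetaScrew_nonneg_of_RH hRH s) fun h0 ↦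
      not_periodic hs (periodic_of_eq_zero hRH h0.symm)
  rcases lt_or_gt_of_ne ht with h | h
  · rw [← zetaScrew_neg]; exact key (-t) (neg_pos.2 h)
  · exact key t h

end ZetaScrewThm17

/-- **Suzuki2023 Theorem 1.7** — discharge of the named fact
`Literature.NumberTheory.LFunctions.Suzuki2023_thm17`: the Riemann hypothesis holds iff
`Ψ(t) ≥ 0` for every real `t`; and if RH holds then `Ψ(t) > 0` for `t ≠ 0`.
(`⇐`: `riemannHypothesis_of_zetaScrew_nonneg`, Thm 1.1 (1) + Landau; `⇒` and strictness:
Thm 1.1 (2) under RH, `ZetaScrewThm17.zetaScrew_nonneg_of_RH`, `ZetaScrewThm17.zetaScrew_pos_of_RH`.)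
[cite: Suzuki2023, Thm 1.7] -/
theorem Suzuki2023_thm17_holds : Suzuki2023_thm17 :=
  ⟨⟨fun hRH t ↦ ZetaScrewThm17.zetaScrew_nonneg_of_RH hRH t, riemannHypothesis_of_zetaScrew_nonneg⟩,
    fun hRH _ ht ↦ ZetaScrewThm17.zetaScrew_pos_of_RH hRH ht⟩

end Literature.NumberTheory.LFunctions
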